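import Summits.MatrixMultiplication.MatrixMultiplication.Theses.FarEdgeDescent
import Summits.MatrixMultiplication.MatrixMultiplication.Theorems.FarEdgeDescentCorankOneClasses
import Literature.Computability.AlgebraicComplexity.AsymptoticSpectrumDuality
import Literature.Computability.AlgebraicComplexity.AsymptoticRankMatMul

/-!
# Route `FarEdgeDescent` — no ANCHOR for `AnchoredLogConvexity` from a finite-level map on the
closed support class of `⟨2,2,2⟩` (the lens' remark N12, TYPED)

decomp-mm ROOT cell (D-0178), lens 2 «structural dichotomy: special vs generic», gen 41 (Kernel XVI-c),
answering critic g14 s1: «type N12 as a precise implication schema — name the hypothesis of 28900 it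
would feed, what "anchor" is as a Lean term, and the kernel facts (b3/c4/c6) it composes».

* **The anchor as a Lean term.**  The crux `AnchoredLogConvexity` (stmt-28900) reads
  `∀ m > 1, (ω(1,m,1) − (m+1))² ≤ (ω(1,1,1) − 2) · (ω(1,2m−1,1) − 2m)`; its ANCHOR is the first
  right-hand factor `omegaRect ℂ 1 1 1 - 2 = ω − 2`, the value of the deficit profile at the square.
  Dictionary (`anchor_eq_logb`, every field): `omegaRect K 1 1 1 − 2 = log₂ R̃(⟨2,2,2⟩) − 2`
  (`omegaRect_one_one_one`, ADVXXZ 2025 §3.4 `asymptoticRank_matMulTensor`).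
* **Finite level** (composing Kernel XV: b3 `FarEdgeDescentLineAllChar.fam_algDegeneratesTo_fam_iff`,
  c4/c5 `matMul_closedClass`, c6 `matMul_deleted_incomparable`, every field): a member `T` of the closed
  support class of `⟨2,2,2⟩` (support `= S` or `S` minus one entry) is `⊴`-comparable with `⟨2,2,2⟩`
  in either direction iff it is restriction-EQUIVALENT to `⟨2,2,2⟩` (`matMul_comparable_iff`); on the
  BCZ line this happens only at `q = 1` (`matMul_comparable_fam_iff`), and never for a deleted member
  (`matMul_not_comparable_deleted`).
* **The schema** (`eq_of_monotone_values`): any pair of real values that is monotone along the two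
  possible maps `⟨2,2,2⟩ ⊵ T`, `T ⊵ ⟨2,2,2⟩` is CONSTANT on comparable members; instances: the asymptotic
  rank (`asymptoticRank_eq_of_comparable`, Strassen duality `strassen_duality_asymptoticRank_holds`,
  CVZ 2023 Prop. 1.6) and every universal spectral point (`spectralValue_eq_of_comparable`, CVZ 2023 §1.2).
* **N12 typed** (`anchor_eq_of_comparable`, `anchoredLogConvexity_iff_of_comparable`): for every member
  `T` of the closed support class and every finite-level map between `T` and `⟨2,2,2⟩`,
  `omegaRect K 1 1 1 − 2 = log₂ R̃(T) − 2`; hence substituting the value read off `T` into the anchor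
  slot of 28900 returns 28900 VERBATIM (an `iff`), i.e. the finite level of the dichotomy carries no
  anchor information; contrapositively (`not_comparable_of_asymptoticRank_ne`,
  `not_comparable_of_spectralValue_ne`) a member whose asymptotic rank or spectral value differs from
  that of `⟨2,2,2⟩` is finite-level incomparable with it — which Kernel XV proves UNCONDITIONALLY for
  every member not `≅ ⟨2,2,2⟩`.  What remains (memo U4/U6) are multi-copy / Kronecker-power maps and
  new spectral points, i.e. `ARC`-hard instruments; nothing here bounds `ω`.

No definitions, no `sorry`; supports the aside `SubLogRate` (stmt-25371) as lens instrument only.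
Informal companion: `pub/decomp-mm/decomp-mm-lens-2/gen41/NODE-v41.md`.
-/

set_option linter.dupNamespace false

noncomputable section

namespace Summit.MatrixMultiplication.MatrixMultiplication.Theorems.FarEdgeDescentNoFiniteAnchor

open Literature.Computability.AlgebraicComplexity
open Summit.MatrixMultiplication.MatrixMultiplication.Theorems.FarEdgeDescentSignTwistDet (Leaf2)
open Summit.MatrixMultiplication.MatrixMultiplication.Theorems.FarEdgeDescentWeightFamily
open Summit.MatrixMultiplication.MatrixMultiplication.Theorems.FarEdgeDescentZeroWeightBorderRank
  (fam_one_restricts)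
open Summit.MatrixMultiplication.MatrixMultiplication.Theorems.FarEdgeDescentSpecialClass (pt)
open Summit.MatrixMultiplication.MatrixMultiplication.Theorems.FarEdgeDescentCorankOneClasses
open Summit.MatrixMultiplication.MatrixMultiplication.Theses.FarEdgeDescent (AnchoredLogConvexity)

variable {K : Type} [Field K] {T : Leaf2 → (Fin 2 × Fin 2) → Leaf2 → K}

/-! ## §1 Finite level: comparability with `⟨2,2,2⟩` inside the closed support class -/

/-- **Comparable ⟺ equivalent.**  A member of the closed support class of `⟨2,2,2⟩` (full support, or
any one of the eight single deletions) admits a degeneration from or to `⟨2,2,2⟩` iff it is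
restriction-equivalent to `⟨2,2,2⟩`.  [cite: BurgisserClausenShokrollahi1997, (15.19), §20.2]
[cite: BlaserChristandlZuiddam2017, §2 Lemma 3] -/
theorem matMul_comparable_iff
    (hT : SameSupport T (fam K 1) ∨
      ∃ σ i k : Fin 2, ∀ a x c, (T a x c ≠ 0 ↔ (fam K 1 a x c ≠ 0 ∧ (a, x, c) ≠ pt σ i k))) :
    (AlgDegeneratesTo (matMulTensor K 2 2 (1 + 1)) T ∨ AlgDegeneratesTo T (matMulTensor K 2 2 (1 + 1))) ↔
      (TensorRestrictsTo (matMulTensor K 2 2 (1 + 1)) T ∧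
        TensorRestrictsTo T (matMulTensor K 2 2 (1 + 1))) := by
  have hS : SameSupport (fam K 1) (fam K 1) ∨
      (TensorRestrictsTo (fam K 1) (fam K 0) ∧ TensorRestrictsTo (fam K 0) (fam K 1)) :=
    Or.inl fun _ _ _ => Iff.rfl
  have hT' := closedSupport_equiv hT
  obtain ⟨h₁, h₂⟩ := matMul_closedClass hT'
  obtain ⟨r₁, r₂⟩ := fam_one_restricts K
  refine ⟨fun h => ?_, fun h => Or.inl h.1.algDegeneratesTo⟩
  have hMT : AlgDegeneratesTo (matMulTensor K 2 2 (1 + 1)) T := h.elim id h₂.mpr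
  have hT1 : AlgDegeneratesTo T (fam K 1) := (h₂.mp hMT).trans_restrictsTo r₁
  exact ⟨h₁.mp hMT, ((closedClass_algDegeneratesTo_iff_restrictsTo hT' hS).mp hT1).trans r₂⟩

/-- **On the BCZ line only `𝔖(1) ≅ ⟨2,2,2⟩` is comparable with `⟨2,2,2⟩`**, every field:
`(⟨2,2,2⟩ ⊵ 𝔖(q) ∨ 𝔖(q) ⊵ ⟨2,2,2⟩) ↔ q = 1` (Kernel XV-b `fam_algDegeneratesTo_fam_iff`).
[cite: BlaserChristandlZuiddam2017, §2] [cite: BurgisserClausenShokrollahi1997, §20.2] -/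
theorem matMul_comparable_fam_iff (q : K) :
    (AlgDegeneratesTo (matMulTensor K 2 2 (1 + 1)) (fam K q) ∨
        AlgDegeneratesTo (fam K q) (matMulTensor K 2 2 (1 + 1))) ↔ q = 1 := by
  obtain ⟨r₁, r₂⟩ := fam_one_restricts K
  have e₁ : AlgDegeneratesTo (matMulTensor K 2 2 (1 + 1)) (fam K q) ↔
      AlgDegeneratesTo (fam K 1) (fam K q) :=
    ⟨fun hd => r₂.algDegeneratesTo_trans hd, fun hd => r₁.algDegeneratesTo_trans hd⟩
  have e₂ : AlgDegeneratesTo (fam K q) (matMulTensor K 2 2 (1 + 1)) ↔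
      AlgDegeneratesTo (fam K q) (fam K 1) :=
    ⟨fun hd => hd.trans_restrictsTo r₁, fun hd => hd.trans_restrictsTo r₂⟩
  rw [e₁, e₂, FarEdgeDescentLineAllChar.fam_algDegeneratesTo_fam_iff K,
    FarEdgeDescentLineAllChar.fam_algDegeneratesTo_fam_iff K]
  constructor
  · rintro ((e | e) | (e | e))
    · exact e
    · simpa using e
    · exact e.symm
    · simpa using e
  · exact fun e => Or.inl (Or.inl e)

/-- **A deleted member is comparable with `⟨2,2,2⟩` in neither direction**, every field
(Kernel XV-c `matMul_deleted_incomparable`). [cite: BlaserChristandlZuiddam2017, §2 Lemma 3]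
[cite: BurgisserClausenShokrollahi1997, (15.19)] -/
theorem matMul_not_comparable_deleted (σ i k : Fin 2)
    (hT : ∀ a x c, (T a x c ≠ 0 ↔ (fam K 1 a x c ≠ 0 ∧ (a, x, c) ≠ pt σ i k))) :
    ¬ (AlgDegeneratesTo (matMulTensor K 2 2 (1 + 1)) T ∨
        AlgDegeneratesTo T (matMulTensor K 2 2 (1 + 1))) :=
  fun h => h.elim (matMul_deleted_incomparable σ i k hT).1 (matMul_deleted_incomparable σ i k hT).2

/-! ## §2 The schema: monotone values are constant on finite-level-comparable members -/

/-- **Schema.**  Any pair of real values `φT, φM` that is monotone along the two possible finite-level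
maps (`⟨2,2,2⟩ ⊵ T ⟹ φT ≤ φM`, `T ⊵ ⟨2,2,2⟩ ⟹ φM ≤ φT`) coincides as soon as ONE map exists, for
`T` in the closed support class: both maps then exist (`matMul_closedClass`).
[cite: BurgisserClausenShokrollahi1997, §20.2] -/
theorem eq_of_monotone_values {φT φM : ℝ}
    (hT : SameSupport T (fam K 1) ∨
      ∃ σ i k : Fin 2, ∀ a x c, (T a x c ≠ 0 ↔ (fam K 1 a x c ≠ 0 ∧ (a, x, c) ≠ pt σ i k)))
    (h₁ : AlgDegeneratesTo (matMulTensor K 2 2 (1 + 1)) T → φT ≤ φM)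
    (h₂ : AlgDegeneratesTo T (matMulTensor K 2 2 (1 + 1)) → φM ≤ φT)
    (hcmp : AlgDegeneratesTo (matMulTensor K 2 2 (1 + 1)) T ∨
      AlgDegeneratesTo T (matMulTensor K 2 2 (1 + 1))) : φT = φM := by
  obtain ⟨s₁, s₂⟩ := (matMul_comparable_iff hT).mp hcmp
  exact le_antisymm (h₁ s₁.algDegeneratesTo) (h₂ s₂.algDegeneratesTo)

/-- **Instance: every universal spectral point** takes the same value on the members comparable with
`⟨2,2,2⟩` (spectral points are `⊴`-monotone, Strassen 1988 §3). [cite: ChristandlVranaZuiddam2023, §1.2]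
[cite: Strassen1988, §3] -/
theorem spectralValue_eq_of_comparable {F : SpectralMap K} (hF : IsUniversalSpectralPoint K F)
    (hT : SameSupport T (fam K 1) ∨
      ∃ σ i k : Fin 2, ∀ a x c, (T a x c ≠ 0 ↔ (fam K 1 a x c ≠ 0 ∧ (a, x, c) ≠ pt σ i k)))
    (hcmp : AlgDegeneratesTo (matMulTensor K 2 2 (1 + 1)) T ∨
      AlgDegeneratesTo T (matMulTensor K 2 2 (1 + 1))) :
    F T = F (matMulTensor K 2 2 (1 + 1)) :=
  eq_of_monotone_values hT (fun h => hF.mono_of_algDegeneratesTo h)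
    (fun h => hF.mono_of_algDegeneratesTo h) hcmp

/-- **Instance: the asymptotic rank** is constant on the members comparable with `⟨2,2,2⟩`
(a universal spectral point attaining `R̃(T)`, Strassen duality, is constant by the previous
instance and bounded by `R̃(⟨2,2,2⟩)`; symmetrically). [cite: ChristandlVranaZuiddam2023, Prop. 1.6]
[cite: Strassen1988, §3] -/
theorem asymptoticRank_eq_of_comparable
    (hT : SameSupport T (fam K 1) ∨
      ∃ σ i k : Fin 2, ∀ a x c, (T a x c ≠ 0 ↔ (fam K 1 a x c ≠ 0 ∧ (a, x, c) ≠ pt σ i k)))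
    (hcmp : AlgDegeneratesTo (matMulTensor K 2 2 (1 + 1)) T ∨
      AlgDegeneratesTo T (matMulTensor K 2 2 (1 + 1))) :
    asymptoticRank T = asymptoticRank (matMulTensor K 2 2 (1 + 1)) := by
  refine le_antisymm ?_ ?_
  · obtain ⟨F, hF, hFT⟩ := (strassen_duality_asymptoticRank_holds K T).2
    rw [← hFT, spectralValue_eq_of_comparable hF hT hcmp]
    exact (strassen_duality_asymptoticRank_holds K (matMulTensor K 2 2 (1 + 1))).1 F hF
  · obtain ⟨F, hF, hFM⟩ := (strassen_duality_asymptoticRank_holds K (matMulTensor K 2 2 (1 + 1))).2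
    rw [← hFM, ← spectralValue_eq_of_comparable hF hT hcmp]
    exact (strassen_duality_asymptoticRank_holds K T).1 F hF

/-- Contrapositive instrument form: **a member whose asymptotic rank differs from `R̃(⟨2,2,2⟩)` is
finite-level incomparable with `⟨2,2,2⟩`** — which Kernel XV already proves unconditionally for every
member not `≅ ⟨2,2,2⟩`; a separating value adds nothing at the finite level. [cite: Strassen1988, §3] -/
theorem not_comparable_of_asymptoticRank_ne
    (hT : SameSupport T (fam K 1) ∨
      ∃ σ i k : Fin 2, ∀ a x c, (T a x c ≠ 0 ↔ (fam K 1 a x c ≠ 0 ∧ (a, x, c) ≠ pt σ i k)))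
    (hne : asymptoticRank T ≠ asymptoticRank (matMulTensor K 2 2 (1 + 1))) :
    ¬ (AlgDegeneratesTo (matMulTensor K 2 2 (1 + 1)) T ∨
        AlgDegeneratesTo T (matMulTensor K 2 2 (1 + 1))) :=
  fun h => hne (asymptoticRank_eq_of_comparable hT h)

/-- The same for a separating universal spectral point. [cite: ChristandlVranaZuiddam2023, §1.1] -/
theorem not_comparable_of_spectralValue_ne {F : SpectralMap K} (hF : IsUniversalSpectralPoint K F)
    (hT : SameSupport T (fam K 1) ∨
      ∃ σ i k : Fin 2, ∀ a x c, (T a x c ≠ 0 ↔ (fam K 1 a x c ≠ 0 ∧ (a, x, c) ≠ pt σ i k)))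
    (hne : F T ≠ F (matMulTensor K 2 2 (1 + 1))) :
    ¬ (AlgDegeneratesTo (matMulTensor K 2 2 (1 + 1)) T ∨
        AlgDegeneratesTo T (matMulTensor K 2 2 (1 + 1))) :=
  fun h => hne (spectralValue_eq_of_comparable hF hT h)

/-! ## §3 The anchor as a Lean term: `ω(1,1,1) − 2 = log₂ R̃(⟨2,2,2⟩) − 2` -/

/-- **Dictionary** `log₂ R̃(⟨2,2,2⟩) = ω`, every field.
[cite: AlmanDuanVassilevskaWilliamsXuXuZhou2025, §3.4] -/
theorem logb_asymptoticRank_matMul :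
    Real.logb 2 (asymptoticRank (matMulTensor K 2 2 (1 + 1))) = omega K :=
  (advxxz2025_omega_eq_logb_asymptoticRank K 2 le_rfl).symm

/-- **The anchor of `AnchoredLogConvexity` in asymptotic-rank language**:
`omegaRect K 1 1 1 − 2 = log₂ R̃(⟨2,2,2⟩) − 2`. [cite: AlmanDuanVassilevskaWilliamsXuXuZhou2025, §3.4]
[cite: LottiRomani1983, §1] -/
theorem anchor_eq_logb :
    omegaRect K 1 1 1 - 2 = Real.logb 2 (asymptoticRank (matMulTensor K 2 2 (1 + 1))) - 2 := by
  rw [logb_asymptoticRank_matMul, omegaRect_one_one_one]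

/-! ## §4 N12 typed: a finite-level map reproduces the anchor, it never bounds it -/

/-- **No finite anchor.**  For every member `T` of the closed support class of `⟨2,2,2⟩` and every
finite-level map between `T` and `⟨2,2,2⟩` (a degeneration in either direction), the value read off
`T` IS the anchor: `omegaRect K 1 1 1 − 2 = log₂ R̃(T) − 2`. [cite: Strassen1988, §3]
[cite: BurgisserClausenShokrollahi1997, §20.2] -/
theorem anchor_eq_of_comparable
    (hT : SameSupport T (fam K 1) ∨
      ∃ σ i k : Fin 2, ∀ a x c, (T a x c ≠ 0 ↔ (fam K 1 a x c ≠ 0 ∧ (a, x, c) ≠ pt σ i k)))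
    (hcmp : AlgDegeneratesTo (matMulTensor K 2 2 (1 + 1)) T ∨
      AlgDegeneratesTo T (matMulTensor K 2 2 (1 + 1))) :
    omegaRect K 1 1 1 - 2 = Real.logb 2 (asymptoticRank T) - 2 := by
  rw [anchor_eq_logb, asymptoticRank_eq_of_comparable hT hcmp]

/-- **The implication schema for stmt-28900, closed as an `iff`.**  Feeding the value of a
finite-level-comparable member `T` (over `ℂ`) into the ANCHOR slot `omegaRect ℂ 1 1 1 − 2` of
`AnchoredLogConvexity` returns `AnchoredLogConvexity` verbatim: the finite level of the special/generic
dichotomy on the closed support class carries no anchor information.  (Members NOT comparable with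
`⟨2,2,2⟩` — all deletions, all `𝔖(q)` with `q ≠ 1` — give no inequality at all from monotonicity.)
[cite: Strassen1988, §3] [cite: LottiRomani1983, §1] -/
theorem anchoredLogConvexity_iff_of_comparable {T : Leaf2 → (Fin 2 × Fin 2) → Leaf2 → ℂ}
    (hT : SameSupport T (fam ℂ 1) ∨
      ∃ σ i k : Fin 2, ∀ a x c, (T a x c ≠ 0 ↔ (fam ℂ 1 a x c ≠ 0 ∧ (a, x, c) ≠ pt σ i k)))
    (hcmp : AlgDegeneratesTo (matMulTensor ℂ 2 2 (1 + 1)) T ∨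
      AlgDegeneratesTo T (matMulTensor ℂ 2 2 (1 + 1))) :
    AnchoredLogConvexity ↔
      ∀ m : ℝ, 1 < m → (omegaRect ℂ 1 m 1 - (m + 1)) ^ 2 ≤
        (Real.logb 2 (asymptoticRank T) - 2) * (omegaRect ℂ 1 (2 * m - 1) 1 - 2 * m) := by
  unfold AnchoredLogConvexity
  rw [anchor_eq_of_comparable hT hcmp]

/-- **The only anchor values the finite level offers**, listed: for `T` comparable with `⟨2,2,2⟩`,
`log₂ R̃(T) − 2 = ω − 2` and `F(T) = F(⟨2,2,2⟩)` for every universal spectral point `F` — in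
particular no member comparable with `⟨2,2,2⟩` is "special" (`R̃(T) < R̃(⟨2,2,2⟩)`) or "expensive"
(`R̃(T) > R̃(⟨2,2,2⟩)`). [cite: Strassen1988, §3] [cite: ChristandlVranaZuiddam2023, §1.2] -/
theorem no_special_comparable_member
    (hT : SameSupport T (fam K 1) ∨
      ∃ σ i k : Fin 2, ∀ a x c, (T a x c ≠ 0 ↔ (fam K 1 a x c ≠ 0 ∧ (a, x, c) ≠ pt σ i k)))
    (hcmp : AlgDegeneratesTo (matMulTensor K 2 2 (1 + 1)) T ∨
      AlgDegeneratesTo T (matMulTensor K 2 2 (1 + 1))) :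
    Real.logb 2 (asymptoticRank T) - 2 = omega K - 2 ∧
      ¬ asymptoticRank T < asymptoticRank (matMulTensor K 2 2 (1 + 1)) ∧
      ¬ asymptoticRank (matMulTensor K 2 2 (1 + 1)) < asymptoticRank T ∧
      ∀ F : SpectralMap K, IsUniversalSpectralPoint K F → F T = F (matMulTensor K 2 2 (1 + 1)) := by
  have e := asymptoticRank_eq_of_comparable hT hcmp
  refine ⟨by rw [e, logb_asymptoticRank_matMul], by rw [e]; exact lt_irrefl _,
    by rw [e]; exact lt_irrefl _, fun F hF => spectralValue_eq_of_comparable hF hT hcmp⟩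

end Summit.MatrixMultiplication.MatrixMultiplication.Theorems.FarEdgeDescentNoFiniteAnchor

end
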